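import Summits.BirchSwinnertonDyer.BirchSwinnertonDyer.Theses.GenusKolyvaginAtTwo
import HarnessLib

/-!
# LINE «rational_pair_descent_pos» — SKELETON v1 for the crux U⁺_T `ShaCardDvdPowAtTwoPosT` (stmt-BirchSwinnertonDyer-23378;
# `#Ш(E/K)[2^∞] ∣ 2^(2M₀)` on the Δ>0 odd-Tamagawa habitat), LEAD gk2-p1 g20, route `GenusKolyvaginAtTwo` rev 42, 2026-08-30T01:3xZ

THE LINE = the Δ>0 twin of LINE 19 `rational_pair_descent` (R7, crux dir `Cruxes/ShaCardDvdPowAtTwoRT/`): run Kolyvagin's count over `ℚ` for the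
rank-zero member `E` alone and descend to `K` through a 2-Selmer-minimal twin.  On Δ>0 the `c₀`-Kolyvagin primes lose one bit (frame
`ℤ/2^M ⊕ ℤ/2`), so the `ℚ`-side SHARP EXPONENT (B2Q⁺) is run at REGULAR primes (Frobenius a regular involution `h` on `E[2^(M+1)]`,
`(1+h)E[2^M] ≅ ℤ/2^M`, lossless; gk2-p5 g31 `two_pow_smul_selmer_rat_eq_zero_of_regularPairSupply` p754192 = g22's B2Q with `Δ<0` DELETED,
modulo the signed regular pair-Čebotarev `hPair` = gk2-p4 g23 Part C; archimedean bit free at margin one, ARCH-M1 p752988); the DESCENT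
(gk2-p3 g27: RANKQ⁺ p754093, pair sandwich frame p754092 / sign-free p754145, `…PosTOnCut` next) needs the twin 2-Selmer-minimal with
`ord₂ c(Wd) = 0` (every prime of `d_K` silent — on Δ>0 the number of transposition primes is EVEN, so this IS «`ord₂ c(Wd) ≤ 1`»; the real
place is the one relaxed place) and the rational point of infinite order on `Wd` (LEAD TWINPOINT p754427: `w(E)=1` + `y_K` ⟹ `rank Wd(ℚ)=1`,
`Ш(Wd/ℚ)[2^∞]=0`, sign-free).  The item AS FILED is unconditional and has no cut; its intended lemma Q2 `KolyvaginRelationAtTwo` (24880,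
theorem modulo the print fact `prop37_2_frobeniusCongruence`, p614530) is therefore a STUB here, and everything off the cut is a DECLARED RESIDUAL.

STUBS (sorries ONLY in `stub_*`; `ShaCardDvdPowAtTwoPosT_of_stubs` concludes the crux BY NAME):
* Q2 `stub_kolyvaginRelationAtTwo` — item 24880 by name (print-blocked: Gross 1991 Prop. 3.7 (2) / Eichler–Shimura).  A restated U⁺_T′ with
  `KolyvaginRelationAtTwo →` as antecedent (as Q3R_T′/U_T′ on Δ<0) deletes it.
* B2Q⁺ `stub_b2qSignFree` — the `ℚ`-side sharp exponent `2^M₀ · Sel_(2^M)(E/ℚ) = 0`, SIGN-FREE: g22's `two_pow_smul_selmer_rat_eq_zero_onHabitat`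
  binders with `Δ(E) < 0` DELETED (owner gk2-p5 g31 frame ∘ gk2-p4 g23 signed regular pair-Čebotarev).
* ONCUT⁺ `stub_onCutPos` — the descent: from the B2Q-shape exponent, `w(E) = 1` and a globally minimal 2-Selmer-minimal twin model `Wd ≅ E^(d_K)`
  with `ord₂ c(Wd) = 0`: `#Ш(E/K)[2^∞] ∣ 4^M₀` (owner gk2-p3 g27; LEAD TWINPOINT supplies `rank Wd(ℚ) = 1`, `Ш(Wd/ℚ)[2^∞] = 0`).
* RESIDUAL `stub_residualOffCutPos` — U⁺_T verbatim OFF the cut (no odd multiplicative prime, or `w(E) ≠ 1`, or no such twin): declared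
  residual, BSD-true, no mechanism; the restatement R9 (U⁺_T onto the cut, supply⁺ cut of 22136 on Δ>0, two PosDisc residual slices in `closes`)
  deletes it.
BSD is NOT proved by any of this; U⁺_T is NOT proved; nothing is closed.

References: [McCallumLMS1991] §5 Thm. 5.3–5.4, Cor. 5.6, Prop. 4.7; [Kolyvagin1989Izv] Thm. B₂, §3; [Kolyvagin1990] Thm. A; [GrossLMS1991]
§3 (3.1)–(3.3), §5 Prop. 5.3–5.4; [Kramer1981] Thm. 1, Prop. 3; [MazurRubin2010] Cor. 3.4 (i); [MilneADT2006] I §6.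
-/

set_option linter.dupNamespace false
set_option autoImplicit false

noncomputable section

namespace Summit.BirchSwinnertonDyer.BirchSwinnertonDyer.Cruxes.ShaCardDvdPowAtTwoPosT.RationalPairDescentPos

open scoped Classical
open WeierstrassCurve NumberField IsDedekindDomain Field
open Literature.NumberTheory.GaloisRepresentations Literature.NumberTheory.EllipticCurves
open Literature.NumberTheory.EllipticCurves.ModularForms
open Literature.NumberTheory
open Summit.BirchSwinnertonDyer.BirchSwinnertonDyer.Theses.GenusKolyvaginAtTwo

/-- stub Q2 — **item 24880 `KolyvaginRelationAtTwo` BY NAME** (McCallum Prop. 4.4 «in particular» at `p = 2`; in the tree a theorem modulo the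
print fact `GrossLMS1991.prop37_2_frobeniusCongruence`, gk2-p2 g7 p614530).  The item U⁺_T as filed is unconditional and consumes Q2 as a
lemma; a restated U⁺_T′ with `KolyvaginRelationAtTwo →` as antecedent removes this stub. [cite: McCallumLMS1991, §4 Prop. 4.4]
[cite: GrossLMS1991, Prop. 3.7 (2), Prop. 6.2 (2)] -/
theorem stub_kolyvaginRelationAtTwo : KolyvaginRelationAtTwo := by
  sorry

/-- stub B2Q⁺ — **the `ℚ`-side SHARP EXPONENT, SIGN-FREE**: on the habitat frame (non-CM, odd Tamagawa, an odd multiplicative prime (NPh),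
`K` imaginary quadratic with odd `d_K ≠ −3`, Heegner, the two (H2) non-squares, `ρ_{E,2^n}` onto, `2^(M₀+1) ∤ y_K`, `w(E) = 1`) and for EVERY
sign of `Δ(E)`: `2^M₀ · s = 0` for every `s ∈ Sel_(2^M)(E/ℚ)`.  = g22's `two_pow_smul_selmer_rat_eq_zero_onHabitat` (p748779) with the binder
`W.Δ < 0` DELETED; proof road = gk2-p5 g31 `two_pow_smul_selmer_rat_eq_zero_of_regularPairSupply` (p754192, REGULAR Kolyvagin primes: cyclic
frames for any sign, ARCH-M1 for the real place) ∘ gk2-p4 g23's signed regular pair-Čebotarev (`hPair`); on `Δ < 0` `regularPairSupply_of_Δ_neg`.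
Why it might fail: only the pair-Čebotarev producer (full local orders for a (+)-class and a (−)-class at one regular prime, avoiding the
Lawson–Wuthrich phantom via NPh) is not yet landed. [cite: Kolyvagin1989Izv, Thm. B₂] [cite: McCallumLMS1991, §5 Thm. 5.3, Prop. 4.7]
[cite: GrossLMS1991, §3 (3.1)–(3.3)] -/
theorem stub_b2qSignFree :
    KolyvaginRelationAtTwo →
    ∀ (W : WeierstrassCurve ℚ) [W.IsElliptic] [W.IsGloballyMinimal] [NeZero (W.conductorNorm ℤ)], ¬ W.HasCM → Odd W.tamagawaProduct →
    ∀ (v : HeightOneSpectrum (𝓞 ℚ)), ((2 : ℕ) : 𝓞 ℚ) ∉ v.asIdeal → ((W.conductorNorm ℤ : ℕ) : 𝓞 ℚ) ∈ v.asIdeal →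
      W.HasMultiplicativeReductionAt v →
    ∀ (K : Type) [Field K] [NumberField K], IsImaginaryQuadratic K → Odd (NumberField.discr K) → NumberField.discr K ≠ -3 →
      SatisfiesHeegnerHypothesis (W.conductorNorm ℤ) K →
      ¬ IsSquare ((NumberField.discr K : ℚ) * -|W.Δ|) → ¬ IsSquare ((NumberField.discr K : ℚ) * (-(2 * |W.Δ|))) →
      (∀ n : ℕ, 0 < n → W.HasSurjectiveModNGaloisRep ((2 : ℤ) ^ n)) →
    ∀ (Dt : ModularParametrizationData W (W.conductorNorm ℤ)) (β : ℤ) (ι : K →+* ℂ) (d₁ : KolyvaginHeegnerData Dt β ι 1) (M₀ : ℕ),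
      (¬ ∃ Q : (W.baseChange (ringClassField K ι 1)).toAffine.Point, ((2 ^ (M₀ + 1) : ℕ) : ℤ) • Q = d₁.derivedPoint) →
      W.rootNumber = 1 →
    ∀ (M : ℕ) (s₀ : galH1Torsion W ((2 ^ M : ℕ) : ℤ)), s₀ ∈ selmerGroup W ((2 ^ M : ℕ) : ℤ) → ((2 ^ M₀ : ℕ) : ℤ) • s₀ = 0 := by
  sorry

/-- stub ONCUT⁺ — **the descent on the cut**: on the frame (non-CM, odd Tamagawa, `K` imaginary quadratic with odd `d_K ≠ −3`, Heegner, the two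
(H2) non-squares, `ρ_{E,2^n}` onto, `y_K = P(1)` of infinite order with `2^(M₀+1) ∤ y_K`), GIVEN the B2Q-shape exponent `2^M₀ · Sel_(2^M)(E/ℚ) = 0`
for all `M`, `w(E) = 1`, and a globally minimal 2-Selmer-minimal model `Wd ≅ E^(d_K)` with `ord₂ c(Wd) = 0` (every prime of `d_K` silent):
`#Ш(E/K)[2^∞] ∣ 2^(2M₀)`.  Road (gk2-p3 g27, sign-free): `rank E(ℚ) = 0` and `Ш(E/ℚ)[2^∞]` of exponent `2^M₀` (Kummer + B2Q); RANKQ⁺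
`#Ш(E/ℚ)[2] ∣ 4` (MR Cor. 3.4 (i), `T = {∞}`, p754093) ⟹ `#Ш(E/ℚ)[2^∞] ∣ 4^M₀` (Cassels–Tate filtration); pair sandwich
`2·#Ш(E/K)[2^∞] ≤ #Ш(E/ℚ)[2^∞]·A · #Ш(Wd/ℚ)[2^∞]·A′` with budget `A·A′ ≤ 4` at `ord₂ c(Wd) = 0` (the archimedean bit; p754092/p754145) and
`Ш(Wd/ℚ)[2^∞] = 0`, `rank Wd(ℚ) = 1` (LEAD TWINPOINT p754427) ⟹ `#Ш(E/K)[2^∞] ∣ 2·4^M₀`, squareness refunds the bit.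
Why it might fail: plumbing (binder shapes between the three seats' files). [cite: Kramer1981, Thm. 1, Prop. 3] [cite: MazurRubin2010, Cor. 3.4 (i)]
[cite: GrossLMS1991, §5 Prop. 5.3] [cite: MilneADT2006, I §6] -/
theorem stub_onCutPos :
    ∀ (W : WeierstrassCurve ℚ) [W.IsElliptic] [W.IsGloballyMinimal] [NeZero (W.conductorNorm ℤ)], ¬ W.HasCM → Odd W.tamagawaProduct →
    ∀ (K : Type) [Field K] [NumberField K], IsImaginaryQuadratic K → Odd (NumberField.discr K) → NumberField.discr K ≠ -3 →
      SatisfiesHeegnerHypothesis (W.conductorNorm ℤ) K →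
      ¬ IsSquare ((NumberField.discr K : ℚ) * -|W.Δ|) → ¬ IsSquare ((NumberField.discr K : ℚ) * (-(2 * |W.Δ|))) →
      (∀ n : ℕ, 0 < n → W.HasSurjectiveModNGaloisRep ((2 : ℤ) ^ n)) →
    ∀ (Dt : ModularParametrizationData W (W.conductorNorm ℤ)) (β : ℤ) (ι : K →+* ℂ) (d₁ : KolyvaginHeegnerData Dt β ι 1),
      ¬ IsOfFinAddOrder d₁.derivedPoint → ∀ (M₀ : ℕ),
      (∃ Q : (W.baseChange (ringClassField K ι 1)).toAffine.Point, ((2 ^ M₀ : ℕ) : ℤ) • Q = d₁.derivedPoint) →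
      (¬ ∃ Q : (W.baseChange (ringClassField K ι 1)).toAffine.Point, ((2 ^ (M₀ + 1) : ℕ) : ℤ) • Q = d₁.derivedPoint) →
      (∀ (M : ℕ) (s₀ : galH1Torsion W ((2 ^ M : ℕ) : ℤ)), s₀ ∈ selmerGroup W ((2 ^ M : ℕ) : ℤ) → ((2 ^ M₀ : ℕ) : ℤ) • s₀ = 0) →
      W.rootNumber = 1 → ∀ (Wd : WeierstrassCurve ℚ) [Wd.IsElliptic] [Wd.IsGloballyMinimal],
        (∃ C : WeierstrassCurve.VariableChange ℚ, C • W.quadraticTwist (NumberField.discr K : ℚ) = Wd) →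
        Nat.card (Wd.selmerGroup 2) = 2 → padicValNat 2 Wd.tamagawaProduct = 0 →
        Nat.card (AddCommGroup.primaryComponent (W.baseChange K).sha 2) ∣ 2 ^ (2 * M₀) := by
  sorry

/-- stub RESIDUAL (declared residual; BSD-true; no mechanism in the cell) — U⁺_T VERBATIM off the cut: if `E` has NO odd multiplicative prime
(the non-phantom input of B2Q⁺), or `w(E) ≠ 1`, or NO globally minimal model `Wd` of `E^(d_K)` is 2-Selmer-minimal with `ord₂ c(Wd) = 0`, then
`#Ш(E/K)[2^∞] ∣ 2^(2M₀)` (given Q2).  In `closes` the Δ>0 branch has `r_an(E) = 0` (⟹ `w(E) = 1` by parity) and the twin from the supply 22136;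
restating U⁺_T onto the cut (R9) with a supply⁺ cut (`ord₂ c(Wd) = 0`, narrow Selmer) turns the complement into declared PosDisc residual
slices of the leaf and deletes this stub. [cite: GrossLMS1991, Conj. 1.2 / Thm. 1.3] [cite: Kramer1981, Thm. 1] -/
theorem stub_residualOffCutPos :
    KolyvaginRelationAtTwo →
    ∀ (W : WeierstrassCurve ℚ) [W.IsElliptic] [W.IsGloballyMinimal] [NeZero (W.conductorNorm ℤ)], ¬ W.HasCM → Odd W.tamagawaProduct →
      0 < W.Δ →
    ∀ (K : Type) [Field K] [NumberField K], IsImaginaryQuadratic K → Odd (NumberField.discr K) → NumberField.discr K ≠ -3 →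
      SatisfiesHeegnerHypothesis (W.conductorNorm ℤ) K →
      ¬ IsSquare ((NumberField.discr K : ℚ) * -|W.Δ|) → ¬ IsSquare ((NumberField.discr K : ℚ) * (-(2 * |W.Δ|))) →
      (∀ n : ℕ, 0 < n → W.HasSurjectiveModNGaloisRep ((2 : ℤ) ^ n)) →
    ∀ (Dt : ModularParametrizationData W (W.conductorNorm ℤ)) (β : ℤ) (ι : K →+* ℂ) (d₁ : KolyvaginHeegnerData Dt β ι 1),
      ¬ IsOfFinAddOrder d₁.derivedPoint → ∀ (M₀ : ℕ),
      (∃ Q : (W.baseChange (ringClassField K ι 1)).toAffine.Point, ((2 ^ M₀ : ℕ) : ℤ) • Q = d₁.derivedPoint) →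
      (¬ ∃ Q : (W.baseChange (ringClassField K ι 1)).toAffine.Point, ((2 ^ (M₀ + 1) : ℕ) : ℤ) • Q = d₁.derivedPoint) →
    ∀ (n : ℕ) (d : KolyvaginHeegnerData Dt β ι n), Squarefree n →
      (∀ ℓ ∈ n.primeFactors, Zhang2014.IsKolyvaginPrime (W.conductorNorm ℤ) W K 2 ℓ) →
      (¬ ∃ Q : (W.baseChange (ringClassField K ι n)).toAffine.Point, (2 : ℤ) • Q = d.derivedPoint) →
      (¬ ((∃ v : HeightOneSpectrum (𝓞 ℚ), ((2 : ℕ) : 𝓞 ℚ) ∉ v.asIdeal ∧ ((W.conductorNorm ℤ : ℕ) : 𝓞 ℚ) ∈ v.asIdeal ∧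
            W.HasMultiplicativeReductionAt v) ∧
          W.rootNumber = 1 ∧ ∃ (Wd : WeierstrassCurve ℚ) (_ : Wd.IsElliptic) (_ : Wd.IsGloballyMinimal),
            (∃ C : WeierstrassCurve.VariableChange ℚ, C • W.quadraticTwist (NumberField.discr K : ℚ) = Wd) ∧
            Nat.card (Wd.selmerGroup 2) = 2 ∧ padicValNat 2 Wd.tamagawaProduct = 0)) →
      Nat.card (AddCommGroup.primaryComponent (W.baseChange K).sha 2) ∣ 2 ^ (2 * M₀) := by
  sorry

/-- **Composition (kernel-checked modulo the stubs)**: U⁺_T `ShaCardDvdPowAtTwoPosT` (stmt-BirchSwinnertonDyer-23378) BY NAME.  Q2 from its stub;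
on the cut (an odd multiplicative prime, `w(E) = 1`, a globally minimal 2-Selmer-minimal twin model with `ord₂ c(Wd) = 0`): ONCUT⁺ fed by B2Q⁺;
off it: RESIDUAL.  The Kolyvagin-prime binders `(n) (d) hn hKoly hPn` of the item are idle on the cut. [cite: McCallumLMS1991, §5 Cor. 5.6]
[cite: Kramer1981, Thm. 1] -/
theorem ShaCardDvdPowAtTwoPosT_of_stubs : ShaCardDvdPowAtTwoPosT := by
  intro W _ _ _ hcm hT hpos K _ _ hIQ hodd h3 hHe hsq1 hsq2 hρ Dt β ι d₁ hy M₀ hdiv hndiv n d hn hKoly hPn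
  have hQ2 : KolyvaginRelationAtTwo := stub_kolyvaginRelationAtTwo
  by_cases hcut : (∃ v : HeightOneSpectrum (𝓞 ℚ), ((2 : ℕ) : 𝓞 ℚ) ∉ v.asIdeal ∧ ((W.conductorNorm ℤ : ℕ) : 𝓞 ℚ) ∈ v.asIdeal ∧
        W.HasMultiplicativeReductionAt v) ∧
      W.rootNumber = 1 ∧ ∃ (Wd : WeierstrassCurve ℚ) (_ : Wd.IsElliptic) (_ : Wd.IsGloballyMinimal),
        (∃ C : WeierstrassCurve.VariableChange ℚ, C • W.quadraticTwist (NumberField.discr K : ℚ) = Wd) ∧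
        Nat.card (Wd.selmerGroup 2) = 2 ∧ padicValNat 2 Wd.tamagawaProduct = 0
  · obtain ⟨⟨v, h2v, hNv, hmult⟩, hw, Wd, _, _, hWd, hSel, hTam⟩ := hcut
    have hB2Q : ∀ (M : ℕ) (s₀ : galH1Torsion W ((2 ^ M : ℕ) : ℤ)), s₀ ∈ selmerGroup W ((2 ^ M : ℕ) : ℤ) →
        ((2 ^ M₀ : ℕ) : ℤ) • s₀ = 0 := fun M s₀ hs₀ ↦
      stub_b2qSignFree hQ2 W hcm hT v h2v hNv hmult K hIQ hodd h3 hHe hsq1 hsq2 hρ Dt β ι d₁ M₀ hndiv hw M s₀ hs₀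
    exact stub_onCutPos W hcm hT K hIQ hodd h3 hHe hsq1 hsq2 hρ Dt β ι d₁ hy M₀ hdiv hndiv hB2Q hw Wd hWd hSel hTam
  · exact stub_residualOffCutPos hQ2 W hcm hT hpos K hIQ hodd h3 hHe hsq1 hsq2 hρ Dt β ι d₁ hy M₀ hdiv hndiv n d hn hKoly hPn hcut

end Summit.BirchSwinnertonDyer.BirchSwinnertonDyer.Cruxes.ShaCardDvdPowAtTwoPosT.RationalPairDescentPos

end
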